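import Summits.AtomisticToContinuum.Crystallization.Theses.IsometryAtoms
import Summits.AtomisticToContinuum.Crystallization.Theorems.AtomicLawChargesCrystal.Negative.LatticeLaw
import Summits.AtomisticToContinuum.Crystallization.Theorems.AtomicLawChargesCrystal.Negative.FalseWithoutRelDense

/-!
# Disproof of `AtomicLawChargesCrystal` (stmt-AtomisticToContinuum-15778) — findings

Crux (FIXED; `IsometryAtoms.AtomicLawChargesCrystal`): `∀ δ > 0`, `∀ P` probability law on rooted
configurations of `ℝ³`, [H3] `P`-a.s. `IsRootedHardCore δ`, [H4] `IsPointStationaryLaw P` (Mecke),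
[H5] `P`-a.s. relatively dense, [H6] an atom modulo isometry at some `Y` ⟹ some
`Q : PeriodicConfiguration 3` has every two-way `(R, ε)`-window charged.

## Verdict (cycle 1, refuter-cdisprove, 2026-08-17): NO KILL — the crux is TRUE on paper.
Mecke with `g(μ,y) = 1_{C_a}(μ)·1{‖y‖ ≤ r}` gives `m(a)·#(Y ∩ B̄_r(a)) = Σ_b m(b)·#(Sym(Y)a ∩ B̄_r(b))`;
finiteness of `P` (`Σ_b m(b) ≤ 1`) and relative density (`#(Y ∩ B̄_r) ≥ c r³`) force ONE
`Sym(Y)`-orbit of cubic growth about a fixed centre, hence (discrete `Sym(Y) ⊂ E(3)`, structure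
theorem / Dirichlet cell) finitely many orbits, Bieberbach I, `Y = F + L`, and the atom event lies
in every window event of the `Q` with `Q.points = Y`.  The two-event variant (line `Sketch`, stub
S3') even avoids growth: `m(b)·|Stab b| = m(a)·|Stab a|` for every orbit `b` met, so `#orbits ≤ N/m(a)`.
Measurability of the class events in the Giry σ-algebra holds (σ-compact image of `O(3) × Y` in
the standard-Borel trace on locally finite counting measures).  No counterexample exists unless
one of H1–H6 is dropped; each single deletion IS refuted below or has a paper witness.

## (a) Load-bearing analysis — one `Without<H>` statement per hypothesis
* H5 relative density — FALSE without it: `Negative.FalseWithoutRelDense` (landed, rattack seat;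
  witness `δ_{δ_0}`; the single layer `ℤ² × {0}` and finite clusters are the non-degenerate ones).
  Restated here: `atomicLawChargesCrystal_false_without_relDense`.
* H4 point-stationarity — FALSE without it: witness `δ_{count|(ℤ³ ∪ {(½,½,½)})}` (interstitial
  crystal: probability, ½-hard-core, rel. dense, atom; matches no periodic window: the particle
  forced near `A g`, `g ≠ 0` a period, is `c` ⇒ `-c` would be occupied, is `n ≠ 0` ⇒ `c + n` would
  be occupied, is `0` ⇒ `‖g‖ ≤ ε`).  PROVED, proposal p167172 →
  `Theorems/AtomicLawChargesCrystal/Negative/FalseWithoutPointStationarity.lean`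
  (`atomicLawChargesCrystal_false_without_pointStationarity`, rc0 / 0 sorry); companion
  `InterstitialNotPointStationary.lean` certifies the witness violates EXACTLY H4 (Mecke test
  `g = 1{μ = count|Y₀}`: `∞ = 1`).  Stated below with `sorry` ONLY until the proposal is applied
  (then replaced by a reference).
* H1 `0 < δ` / H3 hard core — FALSE without either: witness `δ_{count|(ℚe₁ ⊕ ℤe₂ ⊕ ℤe₃)}` at
  `δ = 0` (dense countable subgroup: point-stationary by self-invariance, rel. dense via `ℤ³`,
  atom; the second matching clause fails by PIGEONHOLE: `Q.points` is locally finite uniformly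
  along itself, `#(Q.points ∩ B̄(q,2)) ≤ N`, while `Y` has the `N+1` particles `(j/(N+1))e₁` in
  `B̄(0,1)`, pairwise `≥ 1/(N+1) > 2ε` apart).  PROVED (file `FalseWithoutHardCore.lean`, rc0 /
  0 sorry, checked jointly with its import; to be proposed as soon as p167172 is applied):
  `atomicLawChargesCrystal_false_without_delta_pos`, `atomicLawChargesCrystal_false_without_hardCore`.
* H2 `IsProbabilityMeasure P` (finiteness) — load-bearing ON PAPER: the σ-finite ROOTING MEASURE
  `Σ_{q ∈ Y} δ_{count|(Y - q)}` of ANY countable `Y` satisfies the Mecke identity (re-index the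
  double sum), is hard-core / rel. dense / atomic whenever `Y` is Delone, and for a UNIFORMLY
  aperiodic `Y` (every `R`-window at every root non-periodic, e.g. `ℤ³` decorated at `c + n` iff the
  Thue–Morse / Fibonacci letter of `n₁` is `1`) charges no periodic window.  Exactly the place the
  proof divides by `Σ_b m(b) ≤ 1`.  Lean status: the Mecke half is PROVED for every countable `Y`
  (`Negative.RootingMeasure.isPointStationaryLaw_rootingMeasure`, folder file rc0, to be proposed
  after p167172); the window-exclusion half needs overlap-freeness of Thue–Morse (not in Mathlib) —
  near-miss `atomicLawChargesCrystal_false_without_probability` (sorry).  1D REDUCTION for a later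
  seat: with `Y = ℤ³ ∪ (c + {n ∈ ℤ³ : t n₁ = 1})`, a two-way `(R, ε)`-matching of `Y - y₀` with `Q`
  (`ε < 1/8`) makes every `w ∈ A(L_Q) ∩ B̄_R` a `2ε`-approximate period of the window; by compactness
  of the unit sphere some `w` with `‖w‖ ≤ R₀(Q)` has `|w₁| ≥ λ(Q) > 2ε` after the forced alignment
  `w ≈ n ∈ ℤ³`; an integer `n₁ ≠ 0` makes `t` `|n₁|`-periodic on an interval of length `~R`
  (overlap), a half-integer shift would put three consecutive `1`s in `t` (cube) — both excluded by
  overlap-freeness.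
* H6 atom — load-bearing ON PAPER: a diffuse point-stationary hard-core Delone law with long-range
  aperiodic order (Palm law of a Sturmian-stacked layer structure, or of the hull of a strongly
  aperiodic repetitive FLC Delone set) charges no periodic window at large `R`; i.i.d. or
  absolutely-continuous perturbations of `ℤ³` do NOT work (they charge near-perfect windows with
  positive probability — the `ShortRangeStackingBlindness` phenomenon).  Lean status: needs the
  construction of a non-trivial diffuse point-stationary law — out of reach; near-miss
  `atomicLawChargesCrystal_false_without_atom` (sorry).

## (b) Tightness / (c) strengthenings
* The line proves the STRONGER `∃ Q, Q.points = Y` — true under H1–H6 (no slack to exploit).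
* "`P` is SUPPORTED on periodic configurations" is FALSE (mix `δ_{count|ℤ³}` with a diffuse
  point-stationary law; `IsPointStationaryLaw.add`) — nobody claims it; recorded in STRATEGY-CENSUS.
* Quantifier order `∃ Q ∀ R ε` is essential and correct: `∀ R ε ∃ Q` would be trivially true for
  every hard-core law (periodise the observed patch with a huge period).

## Targets — line `Sketch` (PICKED 2026-08-17; 7 stubs), cheap attacks, all SURVIVE
* S2 `stub_measurableSet_isometryClass`: true (σ-compact image; `q ∉ D` allowed — still an
  `O(3)`-orbit image).  No junk instance: `D : Delone.DeloneSet` is non-empty with positive radii.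
  HINT (cheaper than sharp balls, whose counts jump when a point crosses the sphere, making
  `A ↦ #(A(D-q) ∩ B)` only Borel and the image of `O(3)` merely analytic): test against a countable
  family `f_k ∈ C_c(ℝ³)₊` dense in `C_c`; `ι : μ ↦ (∫⁻ f_k dμ)_k` is Giry-measurable
  (`Measure.measurable_lintegral`), `Φ : A ↦ (Σ_{d ∈ D} f_k (A (d - q)))_k` is CONTINUOUS on the
  compact `O(3)` (locally finite sums), so `Φ(O(3))` is compact, hence closed/Borel in `[0,∞]^ℕ`, and
  the class event is `ι⁻¹(Φ(O(3)))`: equality of all `∫ f_k` with those of `count|A(D-q)` forces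
  `μ` finite on compacts and then `μ = count|A(D-q)` by uniqueness of locally finite measures with
  equal integrals on a dense subfamily of `C_c` (Riesz).
* SB `stub_stabiliserBound`: (i) the patch `D ∩ B̄(x, 20R_c)` contains `x` and `p_i` with
  `‖p_i - x - 10R_c e_i‖ ≤ R_c`, an affine frame since `‖E‖_op ≤ √3 R_c < 10 R_c`; (ii) faithful
  action on a patch of uniformly bounded cardinality.  Constant `20` has slack (≥ 12 works).
* S3' `stub_finiteOrbitsOfChargedClass`: true by two-event Mecke + inversion; NOTE it uses neither
  relative density of the LAW nor `d = 3` — only `D` Delone (for discreteness / stabilisers) and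
  the stabiliser bound; the canopy tree (unbounded stabilisers) is the only obstruction pattern and
  it is excluded by hypothesis.  δ-consistency: on the charged atom some realisation is
  δ-hard-core, so `D` is δ-separated automatically.
* TK `stub_so3Toolkit`: T1 holds for ALL linear isometries with `‖A - 1‖ ≤ 1/2` (an eigenvalue `-1`
  would give `‖Ax - x‖ = 2‖x‖`; so `det A = 1`, axis exists); T2/T5/T7 are statements about
  rotations with a common axis; T0 is compactness of `O(3)`.  All true; constants have slack.
* G1a `stub_smallPartsCommute`: true for EVERY Delone `D` (commutator contraction
  `‖C_{j+1} - 1‖ ≤ 2‖A₁ - 1‖‖C_j - 1‖`, translation parts contract, SB(i) turns "moves the patch by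
  < packing radius" into `κ_J = 1`, then unwind with T2).  Relative density IS needed: `D = {0}`
  (uniformly discrete, not Delone) has `Sym = O(3)` whose small elements do not commute.
* FPG / LFP: Bieberbach I under cocompactness; true.
No stub is false; no `Negative/<Stub>False` filed.  Soft spots for the provers (not falsity):
S2 in the FULL Giry σ-algebra (go through countably many ball evaluations + compactness of `O(3)`),
and in S3' evaluate the Mecke right-hand side only on a measurable full-measure set of locally
finite configurations (`lintegral_congr_ae`), as the rattack note already warns.

## Reusable lemmas produced (for provers / later seats)
`ae_eq_dirac_countRestrict`, `dirac_countRestrict_null` (deterministic laws `δ_{count|D}`, `D`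
countable: a.e.-identification and null sets WITHOUT measurability of the event),
`isPointStationaryLaw_dirac_countRestrict_of_sub_mem` (any countable subgroup configuration is
point-stationary), `finite_points_inter_closedBall` / `exists_card_points_near_point_le`
(periodic configurations are locally finite, uniformly along themselves),
`interConfig_not_mem_window` / `denseConfig_not_mem_window` (window-exclusion patterns).
-/

noncomputable section

open MeasureTheory Metric
open scoped ENNReal

namespace Summit.AtomisticToContinuum.Crystallization.Cruxes.AtomicLawChargesCrystal.Disproof

open Literature.Probability.Process
open Literature.MathematicalPhysics.StatisticalMechanics
open Summit.AtomisticToContinuum.Crystallization.Theorems.AtomicLawChargesCrystal.Negative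

local notation "E3" => EuclideanSpace ℝ (Fin 3)

/-- The conclusion of the crux for a law `P`: some periodic `Q` has all its windows charged. -/
def ChargesPeriodicWindows (P : Measure (Measure E3)) : Prop :=
  ∃ Q : PeriodicConfiguration 3, ∀ R ε : ℝ, 0 < R → 0 < ε →
    0 < P {μ | ∃ A : E3 →ₗᵢ[ℝ] E3, ∃ q ∈ Q.points,
      (∀ s ∈ Q.points, dist s q ≤ R → ∃ y : E3, μ {y} ≠ 0 ∧ dist y (A (s - q)) ≤ ε) ∧
      (∀ y : E3, μ {y} ≠ 0 → ‖y‖ ≤ R → ∃ s ∈ Q.points, dist y (A (s - q)) ≤ ε)}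

/-- The atom hypothesis H6 for a law `P`. -/
def HasIsometryAtom (P : Measure (Measure E3)) : Prop :=
  ∃ Y : Set E3, 0 < P {μ | ∃ A : E3 →ₗᵢ[ℝ] E3, ∃ q ∈ Y,
    μ = (Measure.count : Measure E3).restrict ((fun s => A (s - q)) '' Y)}

/-- The relative-density hypothesis H5 for a law `P`. -/
def AERelDense (P : Measure (Measure E3)) : Prop :=
  ∀ᵐ μ ∂P, ∃ R₀ : ℝ, ∀ z : E3, ∃ y : E3, μ {y} ≠ 0 ∧ dist z y ≤ R₀

/-- Sanity: the crux is literally `∀ δ > 0, ∀ P prob, H3 → H4 → H5 → H6 → conclusion` in the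
vocabulary above (definitional unfolding). -/
theorem crux_iff : Summit.AtomisticToContinuum.Crystallization.Theses.IsometryAtoms.AtomicLawChargesCrystal ↔
    ∀ δ : ℝ, 0 < δ → ∀ P : Measure (Measure E3), IsProbabilityMeasure P →
      (∀ᵐ μ ∂P, IsRootedHardCore δ μ) → IsPointStationaryLaw P → AERelDense P → HasIsometryAtom P →
      ChargesPeriodicWindows P :=
  Iff.rfl

/-! ## (a) Load-bearing analysis -/

/-- The crux with H5 (a.s. relative density) deleted. -/
def AtomicLawChargesCrystalWithoutRelDense : Prop :=
  ∀ δ : ℝ, 0 < δ → ∀ P : Measure (Measure E3), IsProbabilityMeasure P →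
    (∀ᵐ μ ∂P, IsRootedHardCore δ μ) → IsPointStationaryLaw P → HasIsometryAtom P →
    ChargesPeriodicWindows P

/-- **H5 is load-bearing** (landed: `Negative.FalseWithoutRelDense`, witness `δ_{δ_0}`). -/
theorem atomicLawChargesCrystal_false_without_relDense : ¬ AtomicLawChargesCrystalWithoutRelDense :=
  FalseWithoutRelDense.atomicLawChargesCrystal_false_without_relDense

/-- The crux with H4 (point-stationarity) deleted. -/
def AtomicLawChargesCrystalWithoutPointStationarity : Prop :=
  ∀ δ : ℝ, 0 < δ → ∀ P : Measure (Measure E3), IsProbabilityMeasure P →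
    (∀ᵐ μ ∂P, IsRootedHardCore δ μ) → AERelDense P → HasIsometryAtom P →
    ChargesPeriodicWindows P

/-- **H4 is load-bearing**: witness `δ_{count|(ℤ³ ∪ {(½,½,½)})}`.  PROVED sorry-free in proposal
p167172 (`Negative.FalseWithoutPointStationarity.atomicLawChargesCrystal_false_without_pointStationarity`,
rc0, axioms standard); the `sorry` below is a placeholder until that module is in the tree and can
be imported here (the statement is the same term). -/
theorem atomicLawChargesCrystal_false_without_pointStationarity :
    ¬ AtomicLawChargesCrystalWithoutPointStationarity := by
  sorry

/-- The crux with H1 (`0 < δ`) deleted: `δ = 0` allowed, the hard core degenerates. -/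
def AtomicLawChargesCrystalWithoutDeltaPos : Prop :=
  ∀ δ : ℝ, ∀ P : Measure (Measure E3), IsProbabilityMeasure P →
    (∀ᵐ μ ∂P, IsRootedHardCore δ μ) → IsPointStationaryLaw P → AERelDense P → HasIsometryAtom P →
    ChargesPeriodicWindows P

/-- The crux with H3 (a.s. hard core) deleted. -/
def AtomicLawChargesCrystalWithoutHardCore : Prop :=
  ∀ δ : ℝ, 0 < δ → ∀ P : Measure (Measure E3), IsProbabilityMeasure P →
    IsPointStationaryLaw P → AERelDense P → HasIsometryAtom P → ChargesPeriodicWindows P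

/-- **H1 is load-bearing**: witness `δ = 0`, `δ_{count|(ℚe₁ ⊕ ℤe₂ ⊕ ℤe₃)}` (pigeonhole against the
uniform local finiteness of `Q.points`).  PROVED sorry-free in folder file `FalseWithoutHardCore.lean`
(`atomicLawChargesCrystal_false_without_delta_pos`, rc0 jointly with its import p167172); placeholder
`sorry` until importable. -/
theorem atomicLawChargesCrystal_false_without_delta_pos : ¬ AtomicLawChargesCrystalWithoutDeltaPos := by
  sorry

/-- **H3 is load-bearing**: same witness (at `δ = 1`).  PROVED sorry-free in folder file
`FalseWithoutHardCore.lean` (`atomicLawChargesCrystal_false_without_hardCore`); placeholder `sorry`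
until importable. -/
theorem atomicLawChargesCrystal_false_without_hardCore : ¬ AtomicLawChargesCrystalWithoutHardCore := by
  sorry

/-- The crux with H2 (`IsProbabilityMeasure P`, i.e. FINITENESS of the law) deleted. -/
def AtomicLawChargesCrystalWithoutProbability : Prop :=
  ∀ δ : ℝ, 0 < δ → ∀ P : Measure (Measure E3),
    (∀ᵐ μ ∂P, IsRootedHardCore δ μ) → IsPointStationaryLaw P → AERelDense P → HasIsometryAtom P →
    ChargesPeriodicWindows P

/-- **NEAR-MISS (H2)**: false on paper — the σ-finite rooting measure `P_Y := Σ_{q ∈ Y} δ_{count|(Y-q)}`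
of a uniformly aperiodic Delone set `Y` (e.g. `ℤ³ ∪ {c + n : n ∈ ℤ³, t(n₁) = 1}`, `t` the Thue–Morse
word, which is overlap-free so no factor of length `≥ 2p+1` is `p`-periodic) satisfies H1, H3–H6 and
charges no periodic window: a matching at radius `R ≫` the periods of `Q` around ANY root forces an
approximate period `A v ≈ n ∈ ℤ³ ∖ {0}` of the decoration pattern on a window of length `~R`, i.e. a
`|n₁|`-periodic (or, if `n₁ = 0` for all three short periods, impossible since they span) factor of
`t` of length `> 2|n₁|+1`.  The Mecke identity for `P_Y` is a pure re-indexing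
`Σ_q Σ_{q'} g(Y-q, q'-q) = Σ_q Σ_{q'} g(Y-q', q-q')`.  Obstruction to closing in Lean: Thue–Morse
overlap-freeness (classical, ~300 lines, not in Mathlib) plus the approximate-period extraction;
tried: looking for a cheaper uniformly aperiodic set — single defects / sparse decorations fail
(far roots see perfect `ℤ³` windows, which `Q = ℤ³` charges). -/
theorem atomicLawChargesCrystal_false_without_probability : ¬ AtomicLawChargesCrystalWithoutProbability := by
  sorry

/-- The crux with H6 (the atom) deleted. -/
def AtomicLawChargesCrystalWithoutAtom : Prop :=
  ∀ δ : ℝ, 0 < δ → ∀ P : Measure (Measure E3), IsProbabilityMeasure P →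
    (∀ᵐ μ ∂P, IsRootedHardCore δ μ) → IsPointStationaryLaw P → AERelDense P →
    ChargesPeriodicWindows P

/-- **NEAR-MISS (H6)**: false on paper — the Palm law of the Sturmian-stacked layer structure
`⋃_k (ℤ² + (s_k/2) e₁) × {k}`, `s_k = ⌊(k+1)α + θ⌋ - ⌊kα + θ⌋`, `α ∉ ℚ`, `θ` uniform (re-rooted at a
uniformly chosen point; point-stationary as the Palm version of a stationary ergodic process), is
1-hard-core and relatively dense, has NO atom modulo isometry, and charges no periodic window at
radii beyond the period of `Q` (a charged window of height `2R+1` would be a factor of the periodic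
stacking word of `Q` for every `R`, putting a periodic point in the minimal aperiodic Sturmian hull).
WARNING for would-be refuters: i.i.d. stackings and absolutely continuous perturbations of `ℤ³` are
NOT witnesses (they charge near-perfect `ℤ³` windows with positive probability).  Obstruction in
Lean: constructing a non-trivial diffuse point-stationary law (Palm calculus / unique ergodicity of
the Sturmian hull) — out of reach this cycle. -/
theorem atomicLawChargesCrystal_false_without_atom : ¬ AtomicLawChargesCrystalWithoutAtom := by
  sorry

/-! ## (b) Non-vacuity and the shape of the conclusion -/

/-- The frame H1–H6 is inhabited by a genuine crystal law (landed: `Negative.LatticeLaw`), so the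
crux is not true for lack of instances; for this `P` the conclusion holds with `Q.points = ℤ³`. -/
theorem frame_inhabited : ∃ P : Measure (Measure E3), IsProbabilityMeasure P ∧
    (∀ᵐ μ ∂P, IsRootedHardCore 1 μ) ∧ IsPointStationaryLaw P ∧ AERelDense P ∧ HasIsometryAtom P :=
  LatticeLaw.frame_inhabited

end Summit.AtomisticToContinuum.Crystallization.Cruxes.AtomicLawChargesCrystal.Disproof
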